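import Summits.Ventures.HodgeRepro2.T5Sl2LowestWeight

/-!
# Irreducible lowest-weight modules of an `sl₂`-triple are determined by their lowest weight

Tier-5 support (N4.3 = (R3), step (P2′) «Bargmann's list: weights bounded below starting at 3 ⇒
π₃⁺»; route/T5-SUPPORT-p1.md §S4).  Continuation of `T5Sl2LowestWeight`: for an `sl₂`-triple
`(h, e, f)` spanning the Lie algebra `L`, over a field `K` of characteristic zero, and an
irreducible module with a lowest-weight vector `m` of weight `μ ∉ −ℕ`,

* `repr_lie_f`: in the e-string basis, the `k`-th coordinate of `⁅f, v⁆` is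
  `(k + 1)(−μ − k)` times the `(k + 1)`-st coordinate of `v`;
* `lie_f_eq_zero_iff` / `ker_toEnd_f`: the vectors killed by `f` are exactly the multiples of
  `m` — the lowest weight line is unique; `eq_of_hasLowestWeightVector`: any lowest-weight vector
  of the module is a multiple of `m` and has weight `μ`;
* `stringEquiv` / `lieEquiv`: two irreducible modules with lowest-weight vectors of the SAME
  weight `μ` are isomorphic as Lie modules, by `eⁿ m ↦ eⁿ m'` (`lieEquiv_apply_pow`);
  `nonempty_lieModuleEquiv`, and for `μ = 3` `nonempty_lieModuleEquiv_of_three`.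

So, algebraically, «lowest weight 3» determines the module up to isomorphism — the uniqueness
half of the S4 row.  Existence (that `π₃⁺` realises it) and unitarity stay printed inputs ([C]).

Blind lane: Mathlib + own prefix; no sorry; axioms ⊆ {propext, Classical.choice, Quot.sound}.
-/

namespace Summit.Ventures.HodgeRepro2.T5Sl2LowestWeightUnique

open LieModule Module Summit.Ventures.HodgeRepro2.T5Sl2LowestWeight

variable {K L M M' : Type*} [Field K] [CharZero K] [LieRing L] [LieAlgebra K L]
  [AddCommGroup M] [Module K M] [LieRingModule L M] [LieModule K L M]
  [AddCommGroup M'] [Module K M'] [LieRingModule L M'] [LieModule K L M']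
variable {h e f : L} {t : IsSl2Triple h e f} {m : M} {m' : M'} {μ : K}

section Ker

variable [LieModule.IsIrreducible K L M]

/-- The coordinates of `⁅f, v⁆` in the e-string basis: the `k`-th coordinate of `⁅f, v⁆` is
`(k + 1)(−μ − k)` times the `(k + 1)`-st coordinate of `v`. -/
lemma repr_lie_f (P : HasLowestWeightVector t m μ) (hμ : ∀ n : ℕ, μ ≠ -(n : K))
    (hL : t.toLieSubalgebra K = ⊤) (v : M) (k : ℕ) :
    (P.eStringBasis hμ hL).repr ⁅f, v⁆ k =
      ((k : K) + 1) * (-μ - k) * (P.eStringBasis hμ hL).repr v (k + 1) := by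
  have key : Finsupp.lapply k ∘ₗ (P.eStringBasis hμ hL).repr.toLinearMap ∘ₗ toEnd K L M f =
      (((k : K) + 1) * (-μ - k)) •
        (Finsupp.lapply (k + 1) ∘ₗ (P.eStringBasis hμ hL).repr.toLinearMap) := by
    refine (P.eStringBasis hμ hL).ext fun j => ?_
    rcases j with _ | j
    · have h0 : P.eStringBasis hμ hL 0 = m := by simp
      have h1 : (P.eStringBasis hμ hL).repr m (k + 1) = 0 := by
        have hs := Module.Basis.repr_self (P.eStringBasis hμ hL) 0
        rw [h0] at hs
        rw [hs, Finsupp.single_apply]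
        simp
      simp [h0, P.lie_f, h1]
    · simp only [LinearMap.comp_apply, LinearEquiv.coe_coe, toEnd_apply_apply,
        HasLowestWeightVector.eStringBasis_apply, P.lie_f_pow_succ j, map_smul,
        LinearMap.smul_apply, Finsupp.lapply_apply, smul_eq_mul]
      rw [← HasLowestWeightVector.eStringBasis_apply P hμ hL j,
        ← HasLowestWeightVector.eStringBasis_apply P hμ hL (j + 1), Module.Basis.repr_self,
        Module.Basis.repr_self, Finsupp.single_apply, Finsupp.single_apply]
      by_cases hjk : j = k
      · subst hjk; simp
      · simp [hjk]
  have := LinearMap.congr_fun key v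
  simpa using this

/-- In an irreducible lowest-weight module, `⁅f, v⁆ = 0` exactly when `v` is a multiple of the
lowest-weight vector: the lowest weight line is `{v | ⁅f, v⁆ = 0}`. -/
lemma lie_f_eq_zero_iff (P : HasLowestWeightVector t m μ) (hμ : ∀ n : ℕ, μ ≠ -(n : K))
    (hL : t.toLieSubalgebra K = ⊤) (v : M) : ⁅f, v⁆ = 0 ↔ v ∈ (K ∙ m) := by
  constructor
  · intro hv
    have hcoord : ∀ k, (P.eStringBasis hμ hL).repr v (k + 1) = 0 := fun k => by
      have := repr_lie_f P hμ hL v k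
      rw [hv, map_zero, Finsupp.zero_apply] at this
      exact (mul_eq_zero.mp this.symm).resolve_left (coeff_ne_zero hμ k)
    have hrepr : (P.eStringBasis hμ hL).repr v =
        Finsupp.single 0 ((P.eStringBasis hμ hL).repr v 0) := by
      ext k
      rcases k with _ | k
      · simp
      · simp [hcoord k]
    have hv' : v = ((P.eStringBasis hμ hL).repr v 0) • m := by
      have := congrArg (P.eStringBasis hμ hL).repr.symm hrepr
      rw [LinearEquiv.symm_apply_apply, Module.Basis.repr_symm_single] at this
      simpa using this
    rw [hv']
    exact Submodule.smul_mem _ _ (Submodule.mem_span_singleton_self m)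
  · intro hv
    obtain ⟨a, rfl⟩ := Submodule.mem_span_singleton.mp hv
    rw [lie_smul, P.lie_f, smul_zero]

/-- The kernel of the lowering operator `f` is the lowest weight line `K ∙ m`. -/
lemma ker_toEnd_f (P : HasLowestWeightVector t m μ) (hμ : ∀ n : ℕ, μ ≠ -(n : K))
    (hL : t.toLieSubalgebra K = ⊤) : LinearMap.ker (toEnd K L M f) = K ∙ m := by
  ext v
  rw [LinearMap.mem_ker, toEnd_apply_apply]
  exact lie_f_eq_zero_iff P hμ hL v

/-- Any lowest-weight vector of an irreducible lowest-weight module is a multiple of `m` and has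
the same weight `μ`: the lowest weight and the lowest weight line are unique. -/
lemma eq_of_hasLowestWeightVector (P : HasLowestWeightVector t m μ)
    (hμ : ∀ n : ℕ, μ ≠ -(n : K)) (hL : t.toLieSubalgebra K = ⊤) {v : M} {μ' : K}
    (Q : HasLowestWeightVector t v μ') : v ∈ (K ∙ m) ∧ μ' = μ := by
  have hv : v ∈ (K ∙ m) := (lie_f_eq_zero_iff P hμ hL v).mp Q.lie_f
  refine ⟨hv, ?_⟩
  obtain ⟨a, rfl⟩ := Submodule.mem_span_singleton.mp hv
  have ha : a ≠ 0 := by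
    rintro rfl
    exact Q.ne_zero (zero_smul K m)
  have h1 := Q.lie_h
  rw [lie_smul, P.lie_h, smul_smul, smul_smul, mul_comm a μ] at h1
  have h2 : (μ' * a - μ * a) • m = 0 := by rw [sub_smul, h1, sub_self]
  have h3 : μ' * a - μ * a = 0 := (smul_eq_zero.mp h2).resolve_right P.ne_zero
  exact mul_right_cancel₀ ha (sub_eq_zero.mp h3)

end Ker

section Equiv

variable [LieModule.IsIrreducible K L M] [LieModule.IsIrreducible K L M']

/-- The linear equivalence `eⁿ m ↦ eⁿ m'` between two irreducible lowest-weight modules of the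
same weight. -/
noncomputable def stringEquiv (P : HasLowestWeightVector t m μ)
    (P' : HasLowestWeightVector t m' μ) (hμ : ∀ n : ℕ, μ ≠ -(n : K))
    (hL : t.toLieSubalgebra K = ⊤) : M ≃ₗ[K] M' :=
  (P.eStringBasis hμ hL).equiv (P'.eStringBasis hμ hL) (Equiv.refl ℕ)

/-- `stringEquiv` sends `eⁿ m` to `eⁿ m'`. -/
@[simp]
lemma stringEquiv_apply_pow (P : HasLowestWeightVector t m μ)
    (P' : HasLowestWeightVector t m' μ) (hμ : ∀ n : ℕ, μ ≠ -(n : K))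
    (hL : t.toLieSubalgebra K = ⊤) (n : ℕ) :
    stringEquiv P P' hμ hL ((toEnd K L M e ^ n) m) = (toEnd K L M' e ^ n) m' := by
  rw [stringEquiv, ← HasLowestWeightVector.eStringBasis_apply P hμ hL n,
    Module.Basis.equiv_apply, Equiv.refl_apply, HasLowestWeightVector.eStringBasis_apply]

/-- `stringEquiv` intertwines `h`. -/
lemma stringEquiv_lie_h (P : HasLowestWeightVector t m μ) (P' : HasLowestWeightVector t m' μ)
    (hμ : ∀ n : ℕ, μ ≠ -(n : K)) (hL : t.toLieSubalgebra K = ⊤) (v : M) :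
    stringEquiv P P' hμ hL ⁅h, v⁆ = ⁅h, stringEquiv P P' hμ hL v⁆ := by
  have key : (stringEquiv P P' hμ hL).toLinearMap ∘ₗ toEnd K L M h =
      toEnd K L M' h ∘ₗ (stringEquiv P P' hμ hL).toLinearMap := by
    refine (P.eStringBasis hμ hL).ext fun n => ?_
    simp only [LinearMap.comp_apply, LinearEquiv.coe_coe, toEnd_apply_apply,
      HasLowestWeightVector.eStringBasis_apply, P.lie_h_pow n, map_smul, stringEquiv_apply_pow,
      P'.lie_h_pow n]
  simpa using LinearMap.congr_fun key v

/-- `stringEquiv` intertwines `e`. -/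
lemma stringEquiv_lie_e (P : HasLowestWeightVector t m μ) (P' : HasLowestWeightVector t m' μ)
    (hμ : ∀ n : ℕ, μ ≠ -(n : K)) (hL : t.toLieSubalgebra K = ⊤) (v : M) :
    stringEquiv P P' hμ hL ⁅e, v⁆ = ⁅e, stringEquiv P P' hμ hL v⁆ := by
  have key : (stringEquiv P P' hμ hL).toLinearMap ∘ₗ toEnd K L M e =
      toEnd K L M' e ∘ₗ (stringEquiv P P' hμ hL).toLinearMap := by
    refine (P.eStringBasis hμ hL).ext fun n => ?_
    simp only [LinearMap.comp_apply, LinearEquiv.coe_coe, toEnd_apply_apply,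
      HasLowestWeightVector.eStringBasis_apply, IsSl2Triple.lie_e_pow_toEnd_e,
      stringEquiv_apply_pow]
  simpa using LinearMap.congr_fun key v

/-- `stringEquiv` intertwines `f`. -/
lemma stringEquiv_lie_f (P : HasLowestWeightVector t m μ) (P' : HasLowestWeightVector t m' μ)
    (hμ : ∀ n : ℕ, μ ≠ -(n : K)) (hL : t.toLieSubalgebra K = ⊤) (v : M) :
    stringEquiv P P' hμ hL ⁅f, v⁆ = ⁅f, stringEquiv P P' hμ hL v⁆ := by
  have key : (stringEquiv P P' hμ hL).toLinearMap ∘ₗ toEnd K L M f =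
      toEnd K L M' f ∘ₗ (stringEquiv P P' hμ hL).toLinearMap := by
    refine (P.eStringBasis hμ hL).ext fun n => ?_
    rcases n with _ | n
    · simp only [LinearMap.comp_apply, LinearEquiv.coe_coe, toEnd_apply_apply,
        HasLowestWeightVector.eStringBasis_apply, P.lie_f_pow_zero, map_zero,
        stringEquiv_apply_pow, P'.lie_f_pow_zero]
    · simp only [LinearMap.comp_apply, LinearEquiv.coe_coe, toEnd_apply_apply,
        HasLowestWeightVector.eStringBasis_apply, P.lie_f_pow_succ n, map_smul,
        stringEquiv_apply_pow, P'.lie_f_pow_succ n]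
  simpa using LinearMap.congr_fun key v

/-- **Uniqueness**: two irreducible modules with lowest-weight vectors of the same weight
`μ ∉ −ℕ` are equivalent as Lie modules (the triple spanning `L`). -/
noncomputable def lieEquiv (P : HasLowestWeightVector t m μ) (P' : HasLowestWeightVector t m' μ)
    (hμ : ∀ n : ℕ, μ ≠ -(n : K)) (hL : t.toLieSubalgebra K = ⊤) : M ≃ₗ⁅K,L⁆ M' where
  toLinearMap := (stringEquiv P P' hμ hL).toLinearMap
  map_lie' {x v} := by
    obtain ⟨c₁, c₂, c₃, rfl⟩ := (IsSl2Triple.mem_toLieSubalgebra_iff (R := K)).mp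
      (by rw [hL]; exact LieSubalgebra.mem_top x)
    simp only [t.lie_e_f, add_lie, smul_lie, map_add, map_smul, LinearEquiv.coe_coe,
      LinearMap.toFun_eq_coe]
    rw [stringEquiv_lie_e, stringEquiv_lie_f, stringEquiv_lie_h]
  invFun := (stringEquiv P P' hμ hL).symm
  left_inv := (stringEquiv P P' hμ hL).left_inv
  right_inv := (stringEquiv P P' hμ hL).right_inv

/-- `lieEquiv` is `stringEquiv` on vectors. -/
@[simp]
lemma lieEquiv_apply (P : HasLowestWeightVector t m μ) (P' : HasLowestWeightVector t m' μ)
    (hμ : ∀ n : ℕ, μ ≠ -(n : K)) (hL : t.toLieSubalgebra K = ⊤) (v : M) :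
    lieEquiv P P' hμ hL v = stringEquiv P P' hμ hL v := rfl

/-- `lieEquiv` sends `eⁿ m` to `eⁿ m'`. -/
lemma lieEquiv_apply_pow (P : HasLowestWeightVector t m μ) (P' : HasLowestWeightVector t m' μ)
    (hμ : ∀ n : ℕ, μ ≠ -(n : K)) (hL : t.toLieSubalgebra K = ⊤) (n : ℕ) :
    lieEquiv P P' hμ hL ((toEnd K L M e ^ n) m) = (toEnd K L M' e ^ n) m' := by
  rw [lieEquiv_apply, stringEquiv_apply_pow]

/-- Two irreducible lowest-weight modules of the same weight `μ ∉ −ℕ` are isomorphic. -/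
theorem nonempty_lieModuleEquiv (P : HasLowestWeightVector t m μ)
    (P' : HasLowestWeightVector t m' μ) (hμ : ∀ n : ℕ, μ ≠ -(n : K))
    (hL : t.toLieSubalgebra K = ⊤) : Nonempty (M ≃ₗ⁅K,L⁆ M') :=
  ⟨lieEquiv P P' hμ hL⟩

/-- Lowest weight `3`: any two irreducible modules with a lowest-weight vector of weight `3` are
isomorphic — «weights bounded below starting at 3» determines the module, algebraically. -/
theorem nonempty_lieModuleEquiv_of_three (P : HasLowestWeightVector t m (3 : K))
    (P' : HasLowestWeightVector t m' (3 : K)) (hL : t.toLieSubalgebra K = ⊤) :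
    Nonempty (M ≃ₗ⁅K,L⁆ M') :=
  nonempty_lieModuleEquiv P P' three_ne_neg hL

end Equiv

end Summit.Ventures.HodgeRepro2.T5Sl2LowestWeightUnique
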